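import Mathlib.Analysis.Complex.Harmonic.Analytic
import Mathlib.Analysis.Complex.AbsMax
import Mathlib.Analysis.SpecialFunctions.Complex.Analytic
import HarnessLib

/-!
# Maximum principles for harmonic functions in the plane

For Mathlib's harmonic functions (`InnerProductSpace.HarmonicOnNhd`, Laplacian-based; on discs
the real parts of holomorphic functions, `HarmonicOnNhd.exists_analyticOnNhd_ball_re_eq`):

* `harmonic_eqOn_of_isMaxOn` — **strong maximum principle**: a harmonic function on an open
  preconnected `U ⊆ ℂ` attaining its maximum over `U` at a point of `U` is constant on `U`
  (locally `f = re F`, `F` holomorphic, and `‖exp F‖ = exp f` attains a maximum, so the maximum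
  modulus principle `Complex.eqOn_of_isPreconnected_of_isMaxOn_norm` makes `f` locally constant;
  clopen argument);
* `harmonic_le_of_frontier_of_cocompact` — **weak maximum principle with boundary values in
  the lim-sup sense** on a possibly unbounded open preconnected `U`: if `lim sup f ≤ M` at every
  finite boundary point (from inside `U`) and at infinity inside `U`, then `f ≤ M` on `U`
  (for `ε > 0` the set `{f ≥ M + ε} ∩ U` is compact, a maximum of `f` over it is a maximum over
  `U`, so `f` would be constant and `U` compact and open, i.e. `U = ℂ`, absurd);
  `harmonic_ge_of_frontier_of_cocompact` — the minimum principle.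

Conway, *Functions of One Complex Variable I* (1978), Ch. X §1 (Maximum Principle, first and
second versions). Mathlib has the mean value property and Poisson's formula for harmonic
functions but (as of this tree's pin) no maximum principle for them.
-/

noncomputable section

open Set Filter Metric Topology Complex InnerProductSpace

namespace Literature.Analysis.Complex

/-! ### The strong maximum principle -/

/-- **Harmonic functions are locally constant near an interior maximum**: if `f` is harmonic on
the disc `B(z, r)` and `f ≤ f z` there, then `f = f z` on the disc. [cite: Conway1978, Ch. X §1 (Maximum Principle, first version)] -/
theorem harmonic_eqOn_ball_of_forall_le {f : ℂ → ℝ} {z : ℂ} {r : ℝ}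
    (hf : HarmonicOnNhd f (ball z r)) (hle : ∀ w ∈ ball z r, f w ≤ f z) :
    EqOn f (fun _ ↦ f z) (ball z r) := by
  rcases le_or_gt r 0 with hr | hr
  · intro w hw
    rw [Metric.ball_eq_empty.2 hr] at hw
    exact hw.elim
  obtain ⟨F, hFa, hFre⟩ := hf.exists_analyticOnNhd_ball_re_eq
  set G : ℂ → ℂ := fun w ↦ exp (F w) with hG
  have hGd : DifferentiableOn ℂ G (ball z r) := (hFa.differentiableOn).cexp
  have hGn : ∀ w ∈ ball z r, ‖G w‖ = Real.exp (f w) := fun w hw ↦ by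
    rw [hG]
    dsimp only
    rw [Complex.norm_exp, ← hFre hw]
  have hmax : IsMaxOn (norm ∘ G) (ball z r) z := fun w hw ↦ by
    simp only [Function.comp, hGn w hw, hGn z (mem_ball_self hr), mem_setOf_eq]
    exact Real.exp_le_exp.2 (hle w hw)
  have heq := Complex.eqOn_of_isPreconnected_of_isMaxOn_norm (convex_ball z r).isPreconnected
    isOpen_ball hGd (mem_ball_self hr) hmax
  intro w hw
  have h1 : ‖G w‖ = ‖G z‖ := by
    have := heq hw
    simp only [Function.const_apply] at this
    rw [this]
  rw [hGn w hw, hGn z (mem_ball_self hr)] at h1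
  exact Real.exp_injective h1

/-- **Strong maximum principle for harmonic functions**: on an open preconnected `U ⊆ ℂ`, a
harmonic function attaining its maximum over `U` at some `c ∈ U` is constant on `U`.
[cite: Conway1978, Ch. X §1 (Maximum Principle, first version)] -/
theorem harmonic_eqOn_of_isMaxOn {U : Set ℂ} (hUo : IsOpen U) (hUc : IsPreconnected U)
    {f : ℂ → ℝ} (hf : HarmonicOnNhd f U) {c : ℂ} (hc : c ∈ U) (hmax : IsMaxOn f U c) :
    EqOn f (fun _ ↦ f c) U := by
  have hcont : ContinuousOn f U := hf.contDiffOn.continuousOn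
  -- the set where the maximum is attained is open …
  set S : Set ℂ := {z : ℂ | z ∈ U ∧ f z = f c} with hS
  have hSo : IsOpen S := by
    rw [isOpen_iff_forall_mem_open]
    rintro z ⟨hzU, hzc⟩
    obtain ⟨r, hr, hball⟩ := Metric.isOpen_iff.1 hUo z hzU
    refine ⟨ball z r, fun w hw ↦ ⟨hball hw, ?_⟩, isOpen_ball, mem_ball_self hr⟩
    have hle : ∀ w ∈ ball z r, f w ≤ f z := fun w hw ↦ by rw [hzc]; exact hmax (hball hw)
    rw [harmonic_eqOn_ball_of_forall_le (hf.mono hball) hle hw, hzc]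
  -- … and its complement in `U` is open
  set V : Set ℂ := {z : ℂ | z ∈ U ∧ f z < f c} with hV
  have hVo : IsOpen V := hcont.isOpen_inter_preimage hUo isOpen_Iio (t := Iio (f c))
  have hcover : U ⊆ S ∪ V := fun z hz ↦ by
    have hle : f z ≤ f c := hmax hz
    rcases hle.lt_or_eq with h | h
    · exact Or.inr ⟨hz, h⟩
    · exact Or.inl ⟨hz, h⟩
  have hdisj : Disjoint S V := Set.disjoint_left.2 fun z hzS hzV ↦ by
    rw [hS, mem_setOf_eq] at hzS
    rw [hV, mem_setOf_eq] at hzV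
    linarith [hzS.2, hzV.2]
  rcases hUc.subset_or_subset hSo hVo hdisj hcover with h | h
  · exact fun z hz ↦ (h hz).2
  · exact absurd (h hc).2 (lt_irrefl _)

/-! ### The weak maximum principle, lim-sup form -/

/-- **Maximum principle for harmonic functions, lim-sup form.** Let `f` be harmonic on an open
preconnected `U ⊆ ℂ`. If `lim sup f ≤ M` at every finite boundary point of `U` (approached from
inside `U`) and at `∞` inside `U`, then `f ≤ M` on `U`. (For bounded `U` the condition at `∞` is
vacuous.) [cite: Conway1978, Ch. X §1 (Maximum Principle, second version)] -/
theorem harmonic_le_of_frontier_of_cocompact {U : Set ℂ} (hUo : IsOpen U) (hUc : IsPreconnected U)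
    {f : ℂ → ℝ} (hf : HarmonicOnNhd f U) {M : ℝ}
    (hbdry : ∀ ζ ∈ frontier U, ∀ ε : ℝ, 0 < ε → ∀ᶠ z in 𝓝[U] ζ, f z ≤ M + ε)
    (hinf : ∀ ε : ℝ, 0 < ε → ∀ᶠ z in cocompact ℂ ⊓ 𝓟 U, f z ≤ M + ε) :
    ∀ z ∈ U, f z ≤ M := by
  have hcont : ContinuousOn f U := hf.contDiffOn.continuousOn
  intro z₀ hz₀
  refine le_of_forall_pos_le_add fun ε hε ↦ ?_
  by_contra hlt
  push Not at hlt
  have hε2 : (0 : ℝ) < ε / 2 := by linarith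
  -- far out, `f ≤ M + ε/2`
  obtain ⟨C, hC, hCU⟩ : ∃ C : Set ℂ, IsCompact C ∧ ∀ z ∈ U, z ∉ C → f z ≤ M + ε / 2 := by
    have h := hinf (ε / 2) hε2
    rw [Filter.eventually_inf_principal] at h
    obtain ⟨C, hC, hsub⟩ := Filter.hasBasis_cocompact.eventually_iff.1 h
    exact ⟨C, hC, fun z hz hzC ↦ hsub hzC hz⟩
  -- the set where `f ≥ M + ε`
  set T : Set ℂ := {z | z ∈ U ∧ M + ε ≤ f z} with hT
  have hz₀T : z₀ ∈ T := ⟨hz₀, hlt.le⟩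
  have hTC : T ⊆ C := fun z hz ↦ by
    by_contra hzC
    linarith [hCU z hz.1 hzC, hz.2]
  have hTU : T ⊆ U := fun z hz ↦ hz.1
  have hTcl : IsClosed T := by
    refine isClosed_of_closure_subset fun t ht ↦ ?_
    haveI : (𝓝[T] t).NeBot := mem_closure_iff_nhdsWithin_neBot.1 ht
    by_cases htU : t ∈ U
    · refine ⟨htU, ?_⟩
      have hc : Tendsto f (𝓝[T] t) (𝓝 (f t)) :=
        ((hcont.continuousAt (hUo.mem_nhds htU)).tendsto).mono_left nhdsWithin_le_nhds
      exact ge_of_tendsto hc (eventually_nhdsWithin_of_forall fun z hz ↦ hz.2)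
    · exfalso
      have htfr : t ∈ frontier U := ⟨closure_mono hTU ht, fun h ↦ htU (interior_subset h)⟩
      have h1 : ∀ᶠ z in 𝓝[T] t, f z ≤ M + ε / 2 :=
        (hbdry t htfr (ε / 2) hε2).filter_mono (nhdsWithin_mono _ hTU)
      have h2 : ∀ᶠ z in 𝓝[T] t, M + ε ≤ f z := eventually_nhdsWithin_of_forall fun z hz ↦ hz.2
      obtain ⟨z, hz1, hz2⟩ := (h1.and h2).exists
      linarith
  have hTcpt : IsCompact T := hC.of_isClosed_subset hTcl hTC
  -- `f` attains its maximum over `T`, hence over `U`, at some `c ∈ T`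
  obtain ⟨c, hcT, hcmax⟩ := hTcpt.exists_isMaxOn ⟨z₀, hz₀T⟩ (hcont.mono hTU)
  have hmaxU : IsMaxOn f U c := by
    intro z hz
    by_cases hzT : z ∈ T
    · exact hcmax hzT
    · have : f z < M + ε := by
        by_contra h
        exact hzT ⟨hz, not_lt.1 h⟩
      show f z ≤ f c
      linarith [hcT.2]
  have heq := harmonic_eqOn_of_isMaxOn hUo hUc hf hcT.1 hmaxU
  -- then `U ⊆ T` is compact and open, hence `U = ℂ`, absurd
  have hUT : U ⊆ T := fun z hz ↦ ⟨hz, by rw [heq hz]; exact hcT.2⟩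
  have hUeq : U = T := Subset.antisymm hUT hTU
  have hUcpt : IsCompact U := hUeq ▸ hTcpt
  have hclopen : IsClopen U := ⟨hUcpt.isClosed, hUo⟩
  rcases isClopen_iff.1 hclopen with h0 | h1
  · rw [h0] at hz₀; exact hz₀
  · rw [h1] at hUcpt
    exact noncompact_univ ℂ hUcpt

/-- **Minimum principle for harmonic functions, lim-inf form** (the maximum principle for
`-f`). [cite: Conway1978, Ch. X §1 (Maximum Principle, second version)] -/
theorem harmonic_ge_of_frontier_of_cocompact {U : Set ℂ} (hUo : IsOpen U) (hUc : IsPreconnected U)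
    {f : ℂ → ℝ} (hf : HarmonicOnNhd f U) {M : ℝ}
    (hbdry : ∀ ζ ∈ frontier U, ∀ ε : ℝ, 0 < ε → ∀ᶠ z in 𝓝[U] ζ, M - ε ≤ f z)
    (hinf : ∀ ε : ℝ, 0 < ε → ∀ᶠ z in cocompact ℂ ⊓ 𝓟 U, M - ε ≤ f z) :
    ∀ z ∈ U, M ≤ f z := by
  have h := harmonic_le_of_frontier_of_cocompact hUo hUc hf.neg (M := -M)
    (fun ζ hζ ε hε ↦ (hbdry ζ hζ ε hε).mono fun z hz ↦ by simp only [Pi.neg_apply]; linarith)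
    (fun ε hε ↦ (hinf ε hε).mono fun z hz ↦ by simp only [Pi.neg_apply]; linarith)
  intro z hz
  have := h z hz
  simp only [Pi.neg_apply] at this
  linarith

end Literature.Analysis.Complex
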